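import Mathlib
import HarnessLib

/-!
# Simulating an event of unknown probability from converging (random) lower and upper bounds:
# the sandwiching `s`-coin of Łatuszyński–Kosmidis–Papaspiliopoulos–Roberts (Algorithms 1–3,
# Lemmas 2.1–2.2)

HONEST FRAMING: exact (Metropolis-corrected) sampling algorithms for lattice gauge theory;
figures of merit are autocorrelation/cost numbers at stated couplings and volumes; no
continuum-physics claim.

Topic `Probability/MarkovChains` (companion of `BernoulliFactoryBarker.lean`, which cites the same
paper's Corollary 3.3).  PUBLISHED RESULT with our formalisation (Mathlib probability:
independence, product measures, Lebesgue/Bochner integrals); every statement proved, no named fact.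

Source (READ at the locators).  K. Łatuszyński, I. Kosmidis, O. Papaspiliopoulos, G. O. Roberts,
*Simulating events of unknown probabilities via reverse time martingales*, Random Structures &
Algorithms 38 (2011) 441–452 [arXiv:0907.4018] [LatuszynskiEtAl2011], §2 "Simulation of events
with unknown probabilities":
* "we assume that we can generate uniformly distributed iid random variables `G_0, G_1, … ∼
  U(0,1)` … to simulate an `s`-coin `C_s` we just let `C_s := 𝕀{G_0 ≤ s}`";
* **Lemma 2.1** "Sampling events of probability `s ∈ [0,1]` is equivalent to constructing an
  unbiased estimator of `s` taking values in `[0,1]` with probability 1" (proof: "`P(C_s = 1) =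
  E 𝕀(G_0 ≤ Ŝ) = E(E(𝕀(G_0 ≤ ŝ) | Ŝ = ŝ)) = E Ŝ = s`"), i.e. **Algorithm 1** ("1. simulate
  `G_0 ∼ U(0,1)`; 2. obtain `Ŝ`; 3. if `G_0 ≤ Ŝ` set `C_s := 1`, otherwise set `C_s := 0`");
* **Algorithm 2** (deterministic bounds `l_n ↑ s`, `u_n ↓ s`: "3. if `G_0 ≤ l_n` set `C_s := 1`;
  4. if `G_0 > u_n` set `C_s := 0`; 5. if `l_n < G_0 ≤ u_n` set `n := n + 1` and GOTO 2") with
  "the algorithm needs `N > n` iterations to stop with probability `inf_{k≤n} u_k − sup_{k≤n} l_k`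
  … we assume that `l_n` is an increasing sequence and `u_n` is a decreasing sequence";
* **Algorithm 3** (the same with RANDOM bounds `L_n ≤ U_n`, `L_n, U_n ∈ [0,1]`, `L_{n−1} ≤ L_n`,
  `U_{n−1} ≥ U_n` (conditions (2)–(4)), `E L_n = l_n ↗ s` and `E U_n = u_n ↘ s` (5)) and
  **Lemma 2.2** "Assume (2), (3), (4) and (5). Then Algorithm 3 outputs a valid `s`-coin.  Moreover
  the probability that it needs `N > n` iterations equals `u_n − l_n`."

Lean reading.  A probability space `(Ω, μ)` carries the uniform variable `G : Ω → ℝ` — used ONLY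
through `μ{G ≤ t} = t` for `t ∈ [0,1]` (`IsUnitUniform`) — and the bounds `L U : ℕ → Ω → ℝ`
(our step `n` is the printed step `n+1`); `G` is independent of the bounds PROCESS
`ω ↦ (n ↦ (L n ω, U n ω))` (the printed "`G_0` … source of randomness", the bounds being computed
from other randomness); conditions (2)–(4) are assumed for every `ω` (the printed "a.s." version
differs by a null modification).  The algorithm's behaviour is described by EVENTS: it has output
`1` iff `G ≤ L_n` for some `n` (`outOne`), output `0` iff `U_n < G` for some `n` (`outZero`), and it
"needs `N > n` iterations" iff it is undecided at every step `k ≤ n` (`undecided`), which under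
monotonicity is the event `L_n < G ≤ U_n` (`undecided_eq`).  Deterministic bounds (Algorithm 2)
are the special case of constant `L n ω = l n`, `U n ω = u n` (`alg2_*`).

Contents (all proved).
* **`measure_le_eq_ofReal_integral` — LEMMA 2.1 / ALGORITHM 1**: for `Ŝ` measurable with values
  in `[0,1]`, independent of `G`: `μ{G ≤ Ŝ} = E Ŝ`.
* `measure_undecided_eq` — **LEMMA 2.2, second claim** (and Algorithm 2's count): `μ{N > n} =
  μ{L_n < G ≤ U_n} = E(U_n − L_n) = u_n − l_n`.
* **`measure_outOne_eq`**, `measure_outZero_eq`, `measure_terminates` — **LEMMA 2.2, first claim**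
  ("outputs a valid `s`-coin"): `μ{output 1} = s`, `μ{output 0} = 1 − s`, the two events are
  disjoint and `μ{terminates} = 1`, where `s = lim l_n = lim u_n`.
* `alg2_measure_undecided_eq`, `alg2_measure_outOne_eq` — ALGORITHM 2 (deterministic bounds).

Deliberate omissions / TODO(general form): Algorithm 4 / Theorem 2.5 (reverse-time super/sub-
martingale bounds) and Theorem 2.7, §3 (the Bernoulli-factory application, of which Corollary 3.3
is in `BernoulliFactoryBarker.lean`) are not formalised; the expected number of iterations
`E N = Σ_n (u_n − l_n)` is recorded only through `μ{N > n}` (the layer-cake sum is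
`RandomizedTruncation.lintegral_level_eq_tsum`).

Context (cell pub-lqcd, HOME/R2-SCOPE.md §3 N1–N4 / D7 noisy EXACT acceptance): an accept/reject
decision with an intractable acceptance probability `s` (e.g. a determinant ratio known through a
convergent expansion with two-sided remainder bounds) can be taken EXACTLY from the bracket
`[L_n, U_n]` refined on demand; the price is the refinement count, `μ{N > n} = u_n − l_n`, i.e.
`E N = Σ_n (u_n − l_n)` — the summed bracket width.
-/

noncomputable section

namespace Literature.Probability.MarkovChains

open _root_.MeasureTheory _root_.ProbabilityTheory Filter Topology Set
open scoped ENNReal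

namespace SandwichCoin

variable {Ω : Type*}

/-! ## The events of Algorithm 3 (random monotone bounds; Algorithm 2 = constant bounds) -/

section Events

variable {G : Ω → ℝ} {L U : ℕ → Ω → ℝ}

/-- OUTPUT `1`: the algorithm stops at some step with "`G_0 ≤ L_n` ⇒ `C_s := 1`".
[cite: LatuszynskiEtAl2011, §2 Algorithm 3 step 3] -/
def outOne (G : Ω → ℝ) (L : ℕ → Ω → ℝ) : Set Ω := {ω | ∃ n, G ω ≤ L n ω}

/-- OUTPUT `0`: the algorithm stops at some step with "`G_0 > U_n` ⇒ `C_s := 0`".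
[cite: LatuszynskiEtAl2011, §2 Algorithm 3 step 4] -/
def outZero (G : Ω → ℝ) (U : ℕ → Ω → ℝ) : Set Ω := {ω | ∃ n, U n ω < G ω}

/-- "NEEDS `N > n` ITERATIONS": undecided ("`L_k < G_0 ≤ U_k` … GOTO 2") at every step `k ≤ n`.
[cite: LatuszynskiEtAl2011, §2 Algorithm 3 step 5, Lemma 2.2] -/
def undecided (G : Ω → ℝ) (L U : ℕ → Ω → ℝ) (n : ℕ) : Set Ω :=
  {ω | ∀ k ≤ n, L k ω < G ω ∧ G ω ≤ U k ω}

/-- Monotone bounds in the printed sense: `L_k ≤ L_n` and `U_n ≤ U_k` for `k ≤ n` (from the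
one-step conditions (4)). [cite: LatuszynskiEtAl2011, §2 condition (4)] -/
theorem bounds_mono (hLmono : ∀ n ω, L n ω ≤ L (n + 1) ω) (hUanti : ∀ n ω, U (n + 1) ω ≤ U n ω)
    {k n : ℕ} (hkn : k ≤ n) (ω : Ω) : L k ω ≤ L n ω ∧ U n ω ≤ U k ω := by
  constructor
  · exact monotone_nat_of_le_succ (f := fun n => L n ω) (fun n => hLmono n ω) hkn
  · exact antitone_nat_of_succ_le (f := fun n => U n ω) (fun n => hUanti n ω) hkn

/-- Under monotonicity, "undecided at every step `k ≤ n`" IS "undecided at step `n`":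
`{N > n} = {L_n < G ≤ U_n}` ("Because we can always obtain monotone bounds … we assume that `l_n`
is an increasing sequence and `u_n` is a decreasing sequence").
[cite: LatuszynskiEtAl2011, §2 (paragraph after Algorithm 2)] -/
theorem undecided_eq (hLmono : ∀ n ω, L n ω ≤ L (n + 1) ω)
    (hUanti : ∀ n ω, U (n + 1) ω ≤ U n ω) (n : ℕ) :
    undecided G L U n = {ω | L n ω < G ω ∧ G ω ≤ U n ω} := by
  ext ω
  simp only [undecided, mem_setOf_eq]
  refine ⟨fun h => h n le_rfl, fun h k hk => ?_⟩
  obtain ⟨hLk, hUk⟩ := bounds_mono hLmono hUanti hk ω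
  exact ⟨lt_of_le_of_lt hLk h.1, h.2.trans hUk⟩

/-- The two outputs EXCLUDE each other (a step with `G ≤ L_n` and a step with `U_m < G` would give
`L_n ≤ L_k ≤ U_k ≤ U_m < G ≤ L_n` at `k = max n m`). [cite: LatuszynskiEtAl2011, §2 conditions
(2), (4)] -/
theorem disjoint_outOne_outZero (hLU : ∀ n ω, L n ω ≤ U n ω)
    (hLmono : ∀ n ω, L n ω ≤ L (n + 1) ω) (hUanti : ∀ n ω, U (n + 1) ω ≤ U n ω) :
    Disjoint (outOne G L) (outZero G U) := by
  rw [Set.disjoint_left]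
  rintro ω ⟨n, hn⟩ ⟨m, hm⟩
  obtain ⟨hL, -⟩ := bounds_mono hLmono hUanti (le_max_left n m) ω
  obtain ⟨-, hU⟩ := bounds_mono hLmono hUanti (le_max_right n m) ω
  have := hLU (max n m) ω
  linarith

/-- The algorithm TERMINATES iff it is decided at some step: `outOne ∪ outZero = ⋃_n (undecided n)ᶜ`.
[cite: LatuszynskiEtAl2011, §2 Algorithm 3 steps 3–6] -/
theorem outOne_union_outZero_eq :
    outOne G L ∪ outZero G U = ⋃ n, (undecided G L U n)ᶜ := by
  ext ω
  simp only [outOne, outZero, undecided, mem_union, mem_setOf_eq, mem_iUnion, mem_compl_iff,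
    not_forall, not_and, not_le, exists_prop]
  constructor
  · rintro (⟨n, hn⟩ | ⟨n, hn⟩)
    · exact ⟨n, n, le_rfl, fun h => absurd hn (not_le.mpr h)⟩
    · exact ⟨n, n, le_rfl, fun _ => hn⟩
  · rintro ⟨n, k, -, hk⟩
    by_cases h : L k ω < G ω
    · exact Or.inr ⟨k, hk h⟩
    · exact Or.inl ⟨k, not_lt.mp h⟩

end Events

variable [MeasurableSpace Ω] {μ : Measure Ω}

/-! ## The uniform source of randomness -/

/-- `G` is a UNIT UNIFORM variable in the only sense the algorithms use: `μ{G ≤ t} = t` for every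
`t ∈ [0,1]` ("`C_s := 𝕀{G_0 ≤ s}`" is an `s`-coin). [cite: LatuszynskiEtAl2011, §2 (first
paragraph)] -/
def IsUnitUniform (μ : Measure Ω) (G : Ω → ℝ) : Prop :=
  ∀ t ∈ Icc (0 : ℝ) 1, μ {ω | G ω ≤ t} = ENNReal.ofReal t

/-- Unfolding lemma. [cite: LatuszynskiEtAl2011, §2 (first paragraph)] -/
theorem isUnitUniform_iff (μ : Measure Ω) (G : Ω → ℝ) :
    IsUnitUniform μ G ↔ ∀ t ∈ Icc (0 : ℝ) 1, μ {ω | G ω ≤ t} = ENNReal.ofReal t := Iff.rfl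

/-- For a unit uniform `G` on a probability space, `μ{t < G} = 1 − t` on `[0,1]`.
[cite: LatuszynskiEtAl2011, §2 Algorithm 2 step 4 ("if `G_0 > u_n` set `C_s := 0`")] -/
theorem IsUnitUniform.measure_gt [IsProbabilityMeasure μ] {G : Ω → ℝ} (hGu : IsUnitUniform μ G)
    (hG : Measurable G) {t : ℝ} (ht : t ∈ Icc (0 : ℝ) 1) :
    μ {ω | t < G ω} = ENNReal.ofReal (1 - t) := by
  have hc : {ω | t < G ω} = {ω | G ω ≤ t}ᶜ := by
    ext ω
    simp only [mem_setOf_eq, mem_compl_iff, not_le]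
  have hs : MeasurableSet {ω | G ω ≤ t} := hG measurableSet_Iic
  rw [hc, prob_compl_eq_one_sub hs, hGu t ht, ENNReal.ofReal_sub _ ht.1, ENNReal.ofReal_one]

/-! ## Lemma 2.1 / Algorithm 1: `P(G ≤ Ŝ) = E Ŝ` -/

/-- A `[0,1]`-valued random variable on a probability space is integrable. [cite:
LatuszynskiEtAl2011, §2 Lemma 2.1 ("`E Ŝ = s`")] -/
theorem integrable_of_mem_Icc [IsProbabilityMeasure μ] {S : Ω → ℝ} (hS : Measurable S)
    (hS01 : ∀ ω, S ω ∈ Icc (0 : ℝ) 1) : Integrable S μ := by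
  refine Integrable.of_bound (C := 1) hS.aestronglyMeasurable (ae_of_all _ fun ω => ?_)
  rw [Real.norm_eq_abs, abs_le]
  constructor <;> linarith [(hS01 ω).1, (hS01 ω).2]

/-- **LEMMA 2.1 / ALGORITHM 1** (Łatuszyński–Kosmidis–Papaspiliopoulos–Roberts): "Sampling events of
probability `s ∈ [0,1]` is equivalent to constructing an unbiased estimator of `s` taking values in
`[0,1]`": if `Ŝ ∈ [0,1]` is independent of the unit uniform `G`, then the coin `C_s := 𝕀{G ≤ Ŝ}`
has `P(C_s = 1) = E 𝕀(G ≤ Ŝ) = E(E(𝕀(G ≤ ŝ) | Ŝ = ŝ)) = E Ŝ`.  Proof as printed, the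
conditioning written as Fubini over the product law of the independent pair `(G, Ŝ)`.
[cite: LatuszynskiEtAl2011, §2 Lemma 2.1 and Algorithm 1] -/
theorem measure_le_eq_ofReal_integral [IsProbabilityMeasure μ] {G S : Ω → ℝ} (hG : Measurable G)
    (hGu : IsUnitUniform μ G) (hS : Measurable S) (hS01 : ∀ ω, S ω ∈ Icc (0 : ℝ) 1)
    (hind : IndepFun G S μ) :
    μ {ω | G ω ≤ S ω} = ENNReal.ofReal (∫ ω, S ω ∂μ) := by
  set E : Set (ℝ × ℝ) := {p | p.1 ≤ p.2} with hEdef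
  have hE : MeasurableSet E := measurableSet_le measurable_fst measurable_snd
  have h1 : {ω | G ω ≤ S ω} = (fun ω => (G ω, S ω)) ⁻¹' E := rfl
  have hpair : Measurable (fun ω => (G ω, S ω)) := hG.prodMk hS
  rw [h1, ← Measure.map_apply hpair hE,
    (indepFun_iff_map_prod_eq_prod_map_map hG.aemeasurable hS.aemeasurable).mp hind,
    Measure.prod_apply_symm hE]
  -- the section of `E` at height `s` is `(-∞, s]`
  have hsec : ∀ s : ℝ, (fun g : ℝ => (g, s)) ⁻¹' E = Iic s := by
    intro s
    ext g
    simp [hEdef]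
  have h2 : ∀ s : ℝ, (μ.map G) ((fun g : ℝ => (g, s)) ⁻¹' E) = μ {ω | G ω ≤ s} := by
    intro s
    rw [hsec s, Measure.map_apply hG measurableSet_Iic]
    rfl
  simp_rw [h2]
  -- `s ↦ μ{G ≤ s}` is monotone, hence measurable
  have hmono : Monotone fun s : ℝ => μ {ω | G ω ≤ s} :=
    fun s s' hss' => measure_mono fun ω (hω : G ω ≤ s) => hω.trans hss'
  rw [lintegral_map hmono.measurable hS]
  rw [lintegral_congr (fun ω => hGu (S ω) (hS01 ω) :
    ∀ ω, μ {ω' | G ω' ≤ S ω} = ENNReal.ofReal (S ω))]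
  rw [← ofReal_integral_eq_lintegral_ofReal (integrable_of_mem_Icc hS hS01)
    (ae_of_all _ fun ω => (hS01 ω).1)]

/-- The complementary count: `μ{Ŝ < G} = 1 − E Ŝ`. [cite: LatuszynskiEtAl2011, §2 Lemma 2.1] -/
theorem measure_gt_eq_ofReal_integral [IsProbabilityMeasure μ] {G S : Ω → ℝ} (hG : Measurable G)
    (hGu : IsUnitUniform μ G) (hS : Measurable S) (hS01 : ∀ ω, S ω ∈ Icc (0 : ℝ) 1)
    (hind : IndepFun G S μ) :
    μ {ω | S ω < G ω} = ENNReal.ofReal (1 - ∫ ω, S ω ∂μ) := by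
  have hc : {ω | S ω < G ω} = {ω | G ω ≤ S ω}ᶜ := by
    ext ω
    simp only [mem_setOf_eq, mem_compl_iff, not_le]
  have hI0 : 0 ≤ ∫ ω, S ω ∂μ := integral_nonneg fun ω => (hS01 ω).1
  rw [hc, prob_compl_eq_one_sub (measurableSet_le hG hS),
    measure_le_eq_ofReal_integral hG hGu hS hS01 hind, ENNReal.ofReal_sub _ hI0, ENNReal.ofReal_one]

/-! ## Algorithm 3 (random monotone bounds) and its events -/

section Algorithm3

variable {G : Ω → ℝ} {L U : ℕ → Ω → ℝ}

/-- Independence of `G` from the bounds process gives independence from each `L_n`, `U_n` and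
`U_n − L_n`. [cite: LatuszynskiEtAl2011, §2 (the `G_i` are the algorithm's own source of
randomness)] -/
theorem indepFun_comp_of_process {φ : (ℕ → ℝ × ℝ) → ℝ} (hφ : Measurable φ)
    (hind : IndepFun G (fun ω (n : ℕ) => (L n ω, U n ω)) μ) :
    IndepFun G (fun ω => φ (fun n => (L n ω, U n ω))) μ := by
  have h := hind.comp measurable_id hφ
  exact h

variable [IsProbabilityMeasure μ]

/-- Measurability of the events. [cite: LatuszynskiEtAl2011, §2 Algorithm 3] -/
theorem measurableSet_outOne (hG : Measurable G) (hLm : ∀ n, Measurable (L n)) :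
    MeasurableSet (outOne G L) := by
  have : outOne G L = ⋃ n, {ω | G ω ≤ L n ω} := by
    ext ω; simp [outOne]
  rw [this]
  exact MeasurableSet.iUnion fun n => measurableSet_le hG (hLm n)

/-- Measurability of the events. [cite: LatuszynskiEtAl2011, §2 Algorithm 3] -/
theorem measurableSet_outZero (hG : Measurable G) (hUm : ∀ n, Measurable (U n)) :
    MeasurableSet (outZero G U) := by
  have : outZero G U = ⋃ n, {ω | U n ω < G ω} := by
    ext ω; simp [outZero]
  rw [this]
  exact MeasurableSet.iUnion fun n => measurableSet_lt (hUm n) hG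

/-- **LEMMA 2.2, second claim** ("the probability that it needs `N > n` iterations equals
`u_n − l_n`"), for RANDOM monotone bounds `L_n ≤ U_n` in `[0,1]` independent of `G`:
`μ{N > n} = μ{L_n < G ≤ U_n} = E U_n − E L_n` ("equals `E(U_n − L_n) = u_n − l_n`").
[cite: LatuszynskiEtAl2011, §2 Lemma 2.2 (second claim) and its proof (first sentence)] -/
theorem measure_undecided_eq (hG : Measurable G) (hGu : IsUnitUniform μ G)
    (hLm : ∀ n, Measurable (L n)) (hUm : ∀ n, Measurable (U n))
    (hLU : ∀ n ω, L n ω ≤ U n ω) (hL01 : ∀ n ω, L n ω ∈ Icc (0 : ℝ) 1)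
    (hU01 : ∀ n ω, U n ω ∈ Icc (0 : ℝ) 1)
    (hLmono : ∀ n ω, L n ω ≤ L (n + 1) ω) (hUanti : ∀ n ω, U (n + 1) ω ≤ U n ω)
    (hind : IndepFun G (fun ω (n : ℕ) => (L n ω, U n ω)) μ) (n : ℕ) :
    μ (undecided G L U n) = ENNReal.ofReal ((∫ ω, U n ω ∂μ) - ∫ ω, L n ω ∂μ) := by
  rw [undecided_eq hLmono hUanti n]
  have hset : {ω | L n ω < G ω ∧ G ω ≤ U n ω} = {ω | G ω ≤ U n ω} \ {ω | G ω ≤ L n ω} := by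
    ext ω
    simp only [mem_setOf_eq, Set.mem_sdiff, not_le]
    tauto
  have hsub : {ω | G ω ≤ L n ω} ⊆ {ω | G ω ≤ U n ω} :=
    fun ω (hω : G ω ≤ L n ω) => hω.trans (hLU n ω)
  have hindL : IndepFun G (L n) μ :=
    indepFun_comp_of_process ((measurable_pi_apply n).fst) hind
  have hindU : IndepFun G (U n) μ :=
    indepFun_comp_of_process ((measurable_pi_apply n).snd) hind
  rw [hset, measure_sdiff hsub (measurableSet_le hG (hLm n)).nullMeasurableSet (measure_ne_top _ _),
    measure_le_eq_ofReal_integral hG hGu (hUm n) (hU01 n) hindU,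
    measure_le_eq_ofReal_integral hG hGu (hLm n) (hL01 n) hindL,
    ENNReal.ofReal_sub _ (integral_nonneg fun ω => (hL01 n ω).1)]

/-- The same count written with `E(U_n − L_n)`. [cite: LatuszynskiEtAl2011, §2 Lemma 2.2 (proof:
"Probability that Algorithm 3 needs more then `n` iterations equals `E(U_n − L_n)`")] -/
theorem measure_undecided_eq' (hG : Measurable G) (hGu : IsUnitUniform μ G)
    (hLm : ∀ n, Measurable (L n)) (hUm : ∀ n, Measurable (U n))
    (hLU : ∀ n ω, L n ω ≤ U n ω) (hL01 : ∀ n ω, L n ω ∈ Icc (0 : ℝ) 1)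
    (hU01 : ∀ n ω, U n ω ∈ Icc (0 : ℝ) 1)
    (hLmono : ∀ n ω, L n ω ≤ L (n + 1) ω) (hUanti : ∀ n ω, U (n + 1) ω ≤ U n ω)
    (hind : IndepFun G (fun ω (n : ℕ) => (L n ω, U n ω)) μ) (n : ℕ) :
    μ (undecided G L U n) = ENNReal.ofReal (∫ ω, (U n ω - L n ω) ∂μ) := by
  rw [measure_undecided_eq hG hGu hLm hUm hLU hL01 hU01 hLmono hUanti hind n,
    integral_sub (integrable_of_mem_Icc (hUm n) (hU01 n)) (integrable_of_mem_Icc (hLm n) (hL01 n))]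

/-- The limit `s` of the mean bounds lies in `[0,1]`. [cite: LatuszynskiEtAl2011, §2 condition (5)]
-/
theorem mem_Icc_of_tendsto (hL01 : ∀ n ω, L n ω ∈ Icc (0 : ℝ) 1) {s : ℝ}
    (hl : Tendsto (fun n => ∫ ω, L n ω ∂μ) atTop (𝓝 s)) : s ∈ Icc (0 : ℝ) 1 := by
  refine isClosed_Icc.mem_of_tendsto hl (Eventually.of_forall fun n => ⟨?_, ?_⟩)
  · exact integral_nonneg fun ω => (hL01 n ω).1
  · calc ∫ ω, L n ω ∂μ ≤ ∫ _ω, (1 : ℝ) ∂μ :=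
          integral_mono_of_nonneg (ae_of_all _ fun ω => (hL01 n ω).1) (integrable_const 1)
            (ae_of_all _ fun ω => (hL01 n ω).2)
      _ = 1 := by simp

/-- **LEMMA 2.2, first claim, output `1`** ("Algorithm 3 outputs a valid `s`-coin"): with
`E L_n = l_n → s`, `μ{output 1} = μ{∃ n, G ≤ L_n} = lim_n μ{G ≤ L_n} = lim_n l_n = s`.
[cite: LatuszynskiEtAl2011, §2 Lemma 2.2 (first claim)] -/
theorem measure_outOne_eq (hG : Measurable G) (hGu : IsUnitUniform μ G)
    (hLm : ∀ n, Measurable (L n)) (hL01 : ∀ n ω, L n ω ∈ Icc (0 : ℝ) 1)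
    (hLmono : ∀ n ω, L n ω ≤ L (n + 1) ω)
    (hind : IndepFun G (fun ω (n : ℕ) => (L n ω, U n ω)) μ) {s : ℝ}
    (hl : Tendsto (fun n => ∫ ω, L n ω ∂μ) atTop (𝓝 s)) :
    μ (outOne G L) = ENNReal.ofReal s := by
  have hset : outOne G L = ⋃ n, {ω | G ω ≤ L n ω} := by
    ext ω; simp [outOne]
  have hmono : Monotone fun n => {ω | G ω ≤ L n ω} := by
    refine monotone_nat_of_le_succ fun n ω (hω : G ω ≤ L n ω) => ?_
    exact hω.trans (hLmono n ω)
  have h1 : Tendsto (fun n => μ {ω | G ω ≤ L n ω}) atTop (𝓝 (μ (outOne G L))) := by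
    rw [hset]
    exact tendsto_measure_iUnion_atTop hmono
  have h2 : Tendsto (fun n => μ {ω | G ω ≤ L n ω}) atTop (𝓝 (ENNReal.ofReal s)) := by
    have e : (fun n => μ {ω | G ω ≤ L n ω}) = fun n => ENNReal.ofReal (∫ ω, L n ω ∂μ) := by
      ext n
      exact measure_le_eq_ofReal_integral hG hGu (hLm n) (hL01 n)
        (indepFun_comp_of_process ((measurable_pi_apply n).fst) hind)
    rw [e]
    exact (ENNReal.continuous_ofReal.tendsto s).comp hl
  exact tendsto_nhds_unique h1 h2

/-- **LEMMA 2.2, first claim, output `0`**: with `E U_n = u_n → s`, `μ{output 0} = μ{∃ n, U_n < G} =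
lim_n (1 − u_n) = 1 − s`. [cite: LatuszynskiEtAl2011, §2 Lemma 2.2 (first claim)] -/
theorem measure_outZero_eq (hG : Measurable G) (hGu : IsUnitUniform μ G)
    (hUm : ∀ n, Measurable (U n)) (hU01 : ∀ n ω, U n ω ∈ Icc (0 : ℝ) 1)
    (hUanti : ∀ n ω, U (n + 1) ω ≤ U n ω)
    (hind : IndepFun G (fun ω (n : ℕ) => (L n ω, U n ω)) μ) {s : ℝ}
    (hu : Tendsto (fun n => ∫ ω, U n ω ∂μ) atTop (𝓝 s)) :
    μ (outZero G U) = ENNReal.ofReal (1 - s) := by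
  have hset : outZero G U = ⋃ n, {ω | U n ω < G ω} := by
    ext ω; simp [outZero]
  have hmono : Monotone fun n => {ω | U n ω < G ω} := by
    refine monotone_nat_of_le_succ fun n ω (hω : U n ω < G ω) => ?_
    exact lt_of_le_of_lt (hUanti n ω) hω
  have h1 : Tendsto (fun n => μ {ω | U n ω < G ω}) atTop (𝓝 (μ (outZero G U))) := by
    rw [hset]
    exact tendsto_measure_iUnion_atTop hmono
  have h2 : Tendsto (fun n => μ {ω | U n ω < G ω}) atTop (𝓝 (ENNReal.ofReal (1 - s))) := by
    have e : (fun n => μ {ω | U n ω < G ω}) = fun n => ENNReal.ofReal (1 - ∫ ω, U n ω ∂μ) := by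
      ext n
      exact measure_gt_eq_ofReal_integral hG hGu (hUm n) (hU01 n)
        (indepFun_comp_of_process ((measurable_pi_apply n).snd) hind)
    rw [e]
    exact (ENNReal.continuous_ofReal.tendsto (1 - s)).comp (tendsto_const_nhds.sub hu)
  exact tendsto_nhds_unique h1 h2

/-- **LEMMA 2.2, first claim, termination** ("The algorithm stops with probability 1 since `l_n`
and `u_n` converge to `s`"): `μ{output 1 or output 0} = s + (1 − s) = 1`.
[cite: LatuszynskiEtAl2011, §2 Lemma 2.2; (paragraph after Algorithm 2)] -/
theorem measure_terminates (hG : Measurable G) (hGu : IsUnitUniform μ G)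
    (hLm : ∀ n, Measurable (L n)) (hUm : ∀ n, Measurable (U n))
    (hLU : ∀ n ω, L n ω ≤ U n ω) (hL01 : ∀ n ω, L n ω ∈ Icc (0 : ℝ) 1)
    (hU01 : ∀ n ω, U n ω ∈ Icc (0 : ℝ) 1)
    (hLmono : ∀ n ω, L n ω ≤ L (n + 1) ω) (hUanti : ∀ n ω, U (n + 1) ω ≤ U n ω)
    (hind : IndepFun G (fun ω (n : ℕ) => (L n ω, U n ω)) μ) {s : ℝ}
    (hl : Tendsto (fun n => ∫ ω, L n ω ∂μ) atTop (𝓝 s))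
    (hu : Tendsto (fun n => ∫ ω, U n ω ∂μ) atTop (𝓝 s)) :
    μ (outOne G L ∪ outZero G U) = 1 := by
  have hs := mem_Icc_of_tendsto hL01 hl
  rw [measure_union (disjoint_outOne_outZero hLU hLmono hUanti) (measurableSet_outZero hG hUm),
    measure_outOne_eq hG hGu hLm hL01 hLmono hind hl,
    measure_outZero_eq hG hGu hUm hU01 hUanti hind hu,
    ← ENNReal.ofReal_add hs.1 (by linarith [hs.2])]
  simp

/-- Termination read on the iteration count: `μ{N > n} → 0`, indeed `μ(⋂_n {N > n}) = 0` — almost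
every run is decided at some step. [cite: LatuszynskiEtAl2011, §2 Lemma 2.2 (proof: "`= l_n − u_n
→ 0` as `n → ∞`")] -/
theorem measure_iInter_undecided_eq_zero (hG : Measurable G) (hGu : IsUnitUniform μ G)
    (hLm : ∀ n, Measurable (L n)) (hUm : ∀ n, Measurable (U n))
    (hLU : ∀ n ω, L n ω ≤ U n ω) (hL01 : ∀ n ω, L n ω ∈ Icc (0 : ℝ) 1)
    (hU01 : ∀ n ω, U n ω ∈ Icc (0 : ℝ) 1)
    (hLmono : ∀ n ω, L n ω ≤ L (n + 1) ω) (hUanti : ∀ n ω, U (n + 1) ω ≤ U n ω)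
    (hind : IndepFun G (fun ω (n : ℕ) => (L n ω, U n ω)) μ) {s : ℝ}
    (hl : Tendsto (fun n => ∫ ω, L n ω ∂μ) atTop (𝓝 s))
    (hu : Tendsto (fun n => ∫ ω, U n ω ∂μ) atTop (𝓝 s)) :
    μ (⋂ n, undecided G L U n) = 0 := by
  have hc : ⋂ n, undecided G L U n = (outOne G L ∪ outZero G U)ᶜ := by
    rw [outOne_union_outZero_eq, Set.compl_iUnion]
    simp only [compl_compl]
  have hm : MeasurableSet (outOne G L ∪ outZero G U) :=
    (measurableSet_outOne hG hLm).union (measurableSet_outZero hG hUm)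
  rw [hc, prob_compl_eq_one_sub hm,
    measure_terminates hG hGu hLm hUm hLU hL01 hU01 hLmono hUanti hind hl hu, tsub_self]

end Algorithm3

/-! ## Algorithm 2: deterministic bounds -/

section Algorithm2

variable [IsProbabilityMeasure μ] {G : Ω → ℝ} {l u : ℕ → ℝ}

/-- **ALGORITHM 2** (deterministic monotone bounds `l_n ↑ s`, `u_n ↓ s` in `[0,1]`): "the algorithm
needs `N > n` iterations to stop with probability" `u_n − l_n`.
[cite: LatuszynskiEtAl2011, §2 Algorithm 2 and the paragraph after it] -/
theorem alg2_measure_undecided_eq (hG : Measurable G) (hGu : IsUnitUniform μ G)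
    (hlu : ∀ n, l n ≤ u n) (hl01 : ∀ n, l n ∈ Icc (0 : ℝ) 1) (hu01 : ∀ n, u n ∈ Icc (0 : ℝ) 1)
    (hlmono : Monotone l) (huanti : Antitone u) (n : ℕ) :
    μ (undecided G (fun n _ => l n) (fun n _ => u n) n) = ENNReal.ofReal (u n - l n) := by
  have hind : IndepFun G (fun _ (n : ℕ) => (l n, u n)) μ := indepFun_const_right G _
  rw [measure_undecided_eq hG hGu (fun n => measurable_const) (fun n => measurable_const)
    (fun n _ => hlu n) (fun n _ => hl01 n) (fun n _ => hu01 n) (fun n _ => hlmono n.le_succ)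
    (fun n _ => huanti n.le_succ) hind n]
  simp

/-- **ALGORITHM 2 outputs an `s`-coin**: `μ{∃ n, G ≤ l_n} = s` when `l_n → s`.
[cite: LatuszynskiEtAl2011, §2 Algorithm 2 ("The algorithm stops with probability 1 since `l_n` and
`u_n` converge to `s` from below and from above")] -/
theorem alg2_measure_outOne_eq (hG : Measurable G) (hGu : IsUnitUniform μ G)
    (hl01 : ∀ n, l n ∈ Icc (0 : ℝ) 1) (hlmono : Monotone l) {s : ℝ}
    (hl : Tendsto l atTop (𝓝 s)) :
    μ (outOne G (fun n _ => l n)) = ENNReal.ofReal s := by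
  have hind : IndepFun G (fun _ (n : ℕ) => (l n, l n)) μ := indepFun_const_right G _
  have hl' : Tendsto (fun n => ∫ _ω, (fun n (_ : Ω) => l n) n _ω ∂μ) atTop (𝓝 s) := by
    simpa using hl
  exact measure_outOne_eq (U := fun n _ => l n) hG hGu (fun n => measurable_const)
    (fun n _ => hl01 n) (fun n _ => hlmono n.le_succ) hind hl'

/-- **ALGORITHM 2 terminates almost surely**. [cite: LatuszynskiEtAl2011, §2 Algorithm 2 (the
sentence after it)] -/
theorem alg2_measure_terminates (hG : Measurable G) (hGu : IsUnitUniform μ G)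
    (hlu : ∀ n, l n ≤ u n) (hl01 : ∀ n, l n ∈ Icc (0 : ℝ) 1) (hu01 : ∀ n, u n ∈ Icc (0 : ℝ) 1)
    (hlmono : Monotone l) (huanti : Antitone u) {s : ℝ}
    (hl : Tendsto l atTop (𝓝 s)) (hu : Tendsto u atTop (𝓝 s)) :
    μ (outOne G (fun n _ => l n) ∪ outZero G (fun n _ => u n)) = 1 := by
  have hind : IndepFun G (fun _ (n : ℕ) => (l n, u n)) μ := indepFun_const_right G _
  have hl' : Tendsto (fun n => ∫ _ω, (fun n (_ : Ω) => l n) n _ω ∂μ) atTop (𝓝 s) := by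
    simpa using hl
  have hu' : Tendsto (fun n => ∫ _ω, (fun n (_ : Ω) => u n) n _ω ∂μ) atTop (𝓝 s) := by
    simpa using hu
  exact measure_terminates hG hGu (fun n => measurable_const) (fun n => measurable_const)
    (fun n _ => hlu n) (fun n _ => hl01 n) (fun n _ => hu01 n) (fun n _ => hlmono n.le_succ)
    (fun n _ => huanti n.le_succ) hind hl' hu'

end Algorithm2

end SandwichCoin

end Literature.Probability.MarkovChains

end

/-!
## §3.1 "Bernoulli factory for alternating series expansions" — Proposition 3.4

APPENDED SECTION (same source, READ at p0007 of arXiv:0907.4018): **Proposition 3.4** "Let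
`f : [0,1] → [0,1]` have an alternating series expansion `f(p) = Σ_{k≥0} (−1)^k a_k p^k` with
`1 ≥ a_0 ≥ a_1 ≥ …`.  Then an `f(p)`-coin can be simulated by Algorithm 3 and the probability that
it needs `N > n` iterations equals `a_n pⁿ`."  Proof as printed: with `p`-coins `X_1, X_2, …`,
"`U_0 := a_0`, `L_0 := 0`, `L_n := U_{n−1} − a_n Π_{k≤n} X_k` (n odd), `:= L_{n−1}` (n even),
`U_n := U_{n−1}` (n odd), `:= L_{n−1} + a_n Π_{k≤n} X_k` (n even) … Clearly (2), (3), (4) and (5)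
are satisfied with `s = f(p)`.  Moreover, `u_n − l_n = E U_n − E L_n = a_n pⁿ ≤ a_n`.  Thus if
`a_n → 0`, the algorithm converges for `p ∈ [0,1]`, otherwise for `p ∈ [0,1)`."

Lean reading: the coins `X : ℕ → Ω → ℝ` take values in `[0,1]` (a `p`-coin takes values in
`{0,1}`), our `X k` is the printed `X_{k+1}`, `coinProd X n = Π_{k<n} X_k` is the printed
`Π_{k=1}^n X_k`; the bounds are the alternating partial sums with an odd (`altUpper`) / even
(`altLower`) number of terms, which is the printed recursion in closed form (`altUpper_zero`,
`altLower_zero`, `altUpper_sub_altLower`); "`p`-coins" enters only through `E Π_{k<n} X_k = pⁿ`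
(`integral_coinProd_eq` derives it from independence), and the convergence hypothesis is the
printed `a_n pⁿ → 0`.
-/

noncomputable section

namespace Literature.Probability.MarkovChains

open _root_.MeasureTheory _root_.ProbabilityTheory Filter Topology Set Finset
open scoped ENNReal

namespace SandwichCoin

variable {Ω : Type*}

section AlternatingSeries

/-- `P_n = Π_{k<n} X_k` — the product of the first `n` coins (`P_0 = 1`).
[cite: LatuszynskiEtAl2011, §3.1 Proposition 3.4 (proof: `Π_{k=1}^n X_k`)] -/
def coinProd (X : ℕ → Ω → ℝ) (n : ℕ) (ω : Ω) : ℝ := ∏ k ∈ range n, X k ω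

/-- The alternating partial sum with `n` terms: `S_n = Σ_{k<n} (−1)^k a_k P_k`.
[cite: LatuszynskiEtAl2011, §3.1 Proposition 3.4] -/
def altPartial (a : ℕ → ℝ) (X : ℕ → Ω → ℝ) (n : ℕ) (ω : Ω) : ℝ :=
  ∑ k ∈ range n, (-1) ^ k * (a k * coinProd X k ω)

/-- LKPR's UPPER bound `U_n`: the partial sum ending with the last even-indexed (positive) term,
`U_n = S_{2⌊n/2⌋+1}` (`U_0 = a_0`, `U_n = U_{n−1}` for odd `n`, `U_n = L_{n−1} + a_n P_n` for even
`n`). [cite: LatuszynskiEtAl2011, §3.1 Proposition 3.4 (proof, definition of `U_n`)] -/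
def altUpper (a : ℕ → ℝ) (X : ℕ → Ω → ℝ) (n : ℕ) (ω : Ω) : ℝ :=
  altPartial a X (2 * (n / 2) + 1) ω

/-- LKPR's LOWER bound `L_n`: the partial sum ending with the last odd-indexed (negative) term,
`L_n = S_{2⌊(n+1)/2⌋}` (`L_0 = 0`, `L_n = U_{n−1} − a_n P_n` for odd `n`, `L_n = L_{n−1}` for even
`n`). [cite: LatuszynskiEtAl2011, §3.1 Proposition 3.4 (proof, definition of `L_n`)] -/
def altLower (a : ℕ → ℝ) (X : ℕ → Ω → ℝ) (n : ℕ) (ω : Ω) : ℝ :=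
  altPartial a X (2 * ((n + 1) / 2)) ω

variable {a : ℕ → ℝ} {X : ℕ → Ω → ℝ}

/-- `U_0 = a_0`. [cite: LatuszynskiEtAl2011, §3.1 Proposition 3.4 (proof)] -/
theorem altUpper_zero (ω : Ω) : altUpper a X 0 ω = a 0 := by
  simp [altUpper, altPartial, coinProd]

/-- `L_0 = 0`. [cite: LatuszynskiEtAl2011, §3.1 Proposition 3.4 (proof)] -/
theorem altLower_zero (ω : Ω) : altLower a X 0 ω = 0 := by
  simp [altLower, altPartial]

/-- `P_{n+1} = P_n · X_n`. [cite: LatuszynskiEtAl2011, §3.1 Proposition 3.4 (proof)] -/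
theorem coinProd_succ (n : ℕ) (ω : Ω) : coinProd X (n + 1) ω = coinProd X n ω * X n ω := by
  simp [coinProd, prod_range_succ]

/-- `0 ≤ P_n ≤ 1` for `[0,1]`-valued coins. [cite: LatuszynskiEtAl2011, §3.1 Proposition 3.4] -/
theorem coinProd_mem_Icc (hX : ∀ k ω, X k ω ∈ Icc (0 : ℝ) 1) (n : ℕ) (ω : Ω) :
    coinProd X n ω ∈ Icc (0 : ℝ) 1 := by
  induction n with
  | zero => simp [coinProd]
  | succ n ih =>
    rw [coinProd_succ]
    exact ⟨mul_nonneg ih.1 (hX n ω).1, mul_le_one₀ ih.2 (hX n ω).1 (hX n ω).2⟩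

/-- The terms `t_k = a_k P_k` are non-negative and non-increasing in `k` (pointwise), because
`a_k ↓`, `a_k ≥ 0` and `P_{k+1} = P_k X_k ≤ P_k`. [cite: LatuszynskiEtAl2011, §3.1 Proposition 3.4
(proof: "Clearly (2), (3), (4) … are satisfied")] -/
theorem term_antitone (ha : Antitone a) (ha0 : ∀ k, 0 ≤ a k) (hX : ∀ k ω, X k ω ∈ Icc (0 : ℝ) 1)
    (ω : Ω) : Antitone fun k => a k * coinProd X k ω := by
  refine antitone_nat_of_succ_le fun k => ?_
  rw [coinProd_succ]
  have hP := coinProd_mem_Icc hX k ω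
  calc a (k + 1) * (coinProd X k ω * X k ω) ≤ a k * (coinProd X k ω * 1) := by
        gcongr
        · exact mul_nonneg hP.1 (hX k ω).1
        · exact ha0 k
        · exact ha k.le_succ
        · exact hP.1
        · exact (hX k ω).2
    _ = a k * coinProd X k ω := by ring

/-- `t_k ≥ 0`. [cite: LatuszynskiEtAl2011, §3.1 Proposition 3.4] -/
theorem term_nonneg (ha0 : ∀ k, 0 ≤ a k) (hX : ∀ k ω, X k ω ∈ Icc (0 : ℝ) 1) (k : ℕ) (ω : Ω) :
    0 ≤ a k * coinProd X k ω :=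
  mul_nonneg (ha0 k) (coinProd_mem_Icc hX k ω).1

/-- Two more terms of an alternating sum with non-increasing terms: `S_{m+2} − S_m = (−1)^m (t_m −
t_{m+1})`. [cite: LatuszynskiEtAl2011, §3.1 Proposition 3.4 (proof)] -/
theorem altPartial_add_two (m : ℕ) (ω : Ω) :
    altPartial a X (m + 2) ω = altPartial a X m ω +
      (-1) ^ m * (a m * coinProd X m ω - a (m + 1) * coinProd X (m + 1) ω) := by
  simp only [altPartial, sum_range_succ, pow_succ]
  ring

/-- **`U_n − L_n = a_n P_n`** (pointwise). [cite: LatuszynskiEtAl2011, §3.1 Proposition 3.4 (proof: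
"`u_n − l_n = E U_n − E L_n = a_n pⁿ`")] -/
theorem altUpper_sub_altLower (n : ℕ) (ω : Ω) :
    altUpper a X n ω - altLower a X n ω = a n * coinProd X n ω := by
  rcases Nat.even_or_odd n with ⟨m, rfl⟩ | ⟨m, rfl⟩
  · -- `n = 2m`: `U_n = S_{2m+1}`, `L_n = S_{2m}`
    have h1 : (m + m) / 2 = m := by omega
    have h2 : (m + m + 1) / 2 = m := by omega
    simp only [altUpper, altLower, h1, h2, altPartial, show 2 * m = m + m by ring, sum_range_succ]
    have : (-1 : ℝ) ^ (m + m) = 1 := by rw [← two_mul, pow_mul]; simp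
    rw [this]
    ring
  · -- `n = 2m+1`: `U_n = S_{2m+1}`, `L_n = S_{2m+2}`
    have h1 : (2 * m + 1) / 2 = m := by omega
    have h2 : (2 * m + 1 + 1) / 2 = m + 1 := by omega
    simp only [altUpper, altLower, h1, h2, altPartial, show 2 * (m + 1) = 2 * m + 1 + 1 by ring,
      sum_range_succ]
    have : (-1 : ℝ) ^ (2 * m + 1) = -1 := by rw [pow_succ, pow_mul]; simp
    rw [this]
    ring

/-- `L_n ≤ U_n` (condition (2)). [cite: LatuszynskiEtAl2011, §3.1 Proposition 3.4 (proof)] -/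
theorem altLower_le_altUpper (ha0 : ∀ k, 0 ≤ a k) (hX : ∀ k ω, X k ω ∈ Icc (0 : ℝ) 1) (n : ℕ)
    (ω : Ω) : altLower a X n ω ≤ altUpper a X n ω := by
  have h := altUpper_sub_altLower (a := a) (X := X) n ω
  have := term_nonneg ha0 hX n ω
  linarith

/-- `L_n ≤ L_{n+1}` (condition (4), lower bounds increase). [cite: LatuszynskiEtAl2011, §3.1
Proposition 3.4 (proof)] -/
theorem altLower_mono (ha : Antitone a) (ha0 : ∀ k, 0 ≤ a k) (hX : ∀ k ω, X k ω ∈ Icc (0 : ℝ) 1)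
    (n : ℕ) (ω : Ω) : altLower a X n ω ≤ altLower a X (n + 1) ω := by
  rcases Nat.even_or_odd n with ⟨m, rfl⟩ | ⟨m, rfl⟩
  · -- `L_{2m} = S_{2m}`, `L_{2m+1} = S_{2m+2}`
    have h1 : (m + m + 1) / 2 = m := by omega
    have h2 : (m + m + 1 + 1) / 2 = m + 1 := by omega
    simp only [altLower, h1, h2, show 2 * (m + 1) = 2 * m + 2 by ring]
    rw [altPartial_add_two]
    have hev : (-1 : ℝ) ^ (2 * m) = 1 := by rw [pow_mul]; simp
    rw [hev, one_mul]
    have := term_antitone ha ha0 hX ω (Nat.le_succ (2 * m))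
    simp only at this
    linarith
  · have h1 : (2 * m + 1 + 1) / 2 = m + 1 := by omega
    have h2 : (2 * m + 1 + 1 + 1) / 2 = m + 1 := by omega
    simp only [altLower, h1, h2, le_refl]

/-- `U_{n+1} ≤ U_n` (condition (4), upper bounds decrease). [cite: LatuszynskiEtAl2011, §3.1
Proposition 3.4 (proof)] -/
theorem altUpper_anti (ha : Antitone a) (ha0 : ∀ k, 0 ≤ a k) (hX : ∀ k ω, X k ω ∈ Icc (0 : ℝ) 1)
    (n : ℕ) (ω : Ω) : altUpper a X (n + 1) ω ≤ altUpper a X n ω := by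
  rcases Nat.even_or_odd n with ⟨m, rfl⟩ | ⟨m, rfl⟩
  · have h1 : (m + m) / 2 = m := by omega
    have h2 : (m + m + 1) / 2 = m := by omega
    simp only [altUpper, h1, h2, le_refl]
  · -- `U_{2m+1} = S_{2m+1}`, `U_{2m+2} = S_{2m+3}`
    have h1 : (2 * m + 1) / 2 = m := by omega
    have h2 : (2 * m + 1 + 1) / 2 = m + 1 := by omega
    simp only [altUpper, h1, h2, show 2 * (m + 1) + 1 = (2 * m + 1) + 2 by ring]
    rw [altPartial_add_two]
    have hodd : (-1 : ℝ) ^ (2 * m + 1) = -1 := by rw [pow_succ, pow_mul]; simp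
    rw [hodd]
    have := term_antitone ha ha0 hX ω (Nat.le_succ (2 * m + 1))
    simp only at this
    linarith

/-- `U_n ≤ U_0 = a_0 ≤ 1` and `0 = L_0 ≤ L_n`, hence `L_n, U_n ∈ [0,1]` (condition (3)).
[cite: LatuszynskiEtAl2011, §3.1 Proposition 3.4 (proof)] -/
theorem altBounds_mem_Icc (ha : Antitone a) (ha0 : ∀ k, 0 ≤ a k) (ha1 : a 0 ≤ 1)
    (hX : ∀ k ω, X k ω ∈ Icc (0 : ℝ) 1) (n : ℕ) (ω : Ω) :
    altLower a X n ω ∈ Icc (0 : ℝ) 1 ∧ altUpper a X n ω ∈ Icc (0 : ℝ) 1 := by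
  have hL0 : altLower a X 0 ω ≤ altLower a X n ω :=
    monotone_nat_of_le_succ (f := fun n => altLower a X n ω) (fun n => altLower_mono ha ha0 hX n ω)
      (Nat.zero_le n)
  have hU0 : altUpper a X n ω ≤ altUpper a X 0 ω :=
    antitone_nat_of_succ_le (f := fun n => altUpper a X n ω) (fun n => altUpper_anti ha ha0 hX n ω)
      (Nat.zero_le n)
  rw [altLower_zero] at hL0
  rw [altUpper_zero] at hU0
  have hLU := altLower_le_altUpper ha0 hX n ω
  exact ⟨⟨hL0, by linarith⟩, ⟨by linarith, by linarith⟩⟩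

variable [MeasurableSpace Ω] {μ : Measure Ω}

/-- Measurability of `P_n`, `S_n`, `L_n`, `U_n`. [cite: LatuszynskiEtAl2011, §3.1 Proposition 3.4]
-/
theorem measurable_coinProd (hXm : ∀ k, Measurable (X k)) (n : ℕ) : Measurable (coinProd X n) := by
  unfold coinProd
  exact Finset.measurable_prod (range n) (fun k _ => hXm k)

/-- Measurability of the partial sums. [cite: LatuszynskiEtAl2011, §3.1 Proposition 3.4] -/
theorem measurable_altPartial (hXm : ∀ k, Measurable (X k)) (n : ℕ) :
    Measurable (altPartial a X n) := by
  unfold altPartial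
  exact Finset.measurable_sum (range n)
    (fun k _ => ((measurable_coinProd hXm k).const_mul (a k)).const_mul _)

/-- "`p`-COINS": for independent coins with mean `p`, `E Π_{k<n} X_k = pⁿ`.
[cite: LatuszynskiEtAl2011, §3.1 Proposition 3.4 (proof: "Let `X_1, X_2, …` be a sequence of
`p`-coins")] -/
theorem integral_coinProd_eq (hXm : ∀ k, Measurable (X k)) (hind : iIndepFun X μ) {p : ℝ}
    (hp : ∀ k, ∫ ω, X k ω ∂μ = p) (n : ℕ) : ∫ ω, coinProd X n ω ∂μ = p ^ n := by
  have hfin : iIndepFun (fun i : Fin n => X i.val) μ := hind.precomp Fin.val_injective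
  have h := hfin.integral_fun_prod_eq_prod_integral (fun i => (hXm i.val).aestronglyMeasurable)
  have e : (fun ω => coinProd X n ω) = fun ω => ∏ i : Fin n, X i.val ω := by
    ext ω
    simp only [coinProd]
    exact (Fin.prod_univ_eq_prod_range (fun k => X k ω) n).symm
  rw [e, h]
  simp only [hp, Finset.prod_const, Finset.card_univ, Fintype.card_fin]

/-- Means of the bounds: `E S_n = Σ_{k<n} (−1)^k a_k E P_k`; with `p`-coins `E U_n − E L_n = a_n pⁿ`.
[cite: LatuszynskiEtAl2011, §3.1 Proposition 3.4 (proof)] -/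
theorem integral_altPartial [IsProbabilityMeasure μ] (hXm : ∀ k, Measurable (X k))
    (hX : ∀ k ω, X k ω ∈ Icc (0 : ℝ) 1) {p : ℝ} (hprod : ∀ n, ∫ ω, coinProd X n ω ∂μ = p ^ n)
    (n : ℕ) : ∫ ω, altPartial a X n ω ∂μ = ∑ k ∈ range n, (-1) ^ k * (a k * p ^ k) := by
  unfold altPartial
  have hi : ∀ k, Integrable (coinProd X k) μ :=
    fun k => integrable_of_mem_Icc (measurable_coinProd hXm k) (coinProd_mem_Icc hX k)
  rw [integral_finsetSum (range n) (fun k _ => ((hi k).const_mul (a k)).const_mul _)]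
  refine sum_congr rfl (fun k _ => ?_)
  rw [integral_const_mul, integral_const_mul, hprod k]

/-- The printed count: **`E U_n − E L_n = a_n pⁿ`**. [cite: LatuszynskiEtAl2011, §3.1 Proposition
3.4 (proof: "`u_n − l_n = E U_n − E L_n = a_n pⁿ ≤ a_n`")] -/
theorem integral_altUpper_sub_altLower [IsProbabilityMeasure μ] (hXm : ∀ k, Measurable (X k))
    (hX : ∀ k ω, X k ω ∈ Icc (0 : ℝ) 1) {p : ℝ} (hprod : ∀ n, ∫ ω, coinProd X n ω ∂μ = p ^ n)
    (n : ℕ) : (∫ ω, altUpper a X n ω ∂μ) - ∫ ω, altLower a X n ω ∂μ = a n * p ^ n := by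
  have hi : ∀ m, Integrable (altPartial a X m) μ := by
    intro m
    unfold altPartial
    exact integrable_finsetSum (range m) (fun k _ =>
      (((integrable_of_mem_Icc (measurable_coinProd hXm k) (coinProd_mem_Icc hX k)).const_mul
        (a k)).const_mul _))
  show (∫ ω, altPartial a X (2 * (n / 2) + 1) ω ∂μ) - ∫ ω, altPartial a X (2 * ((n + 1) / 2)) ω ∂μ
    = a n * p ^ n
  rw [← integral_sub (hi _) (hi _)]
  simp_rw [show ∀ ω, altPartial a X (2 * (n / 2) + 1) ω - altPartial a X (2 * ((n + 1) / 2)) ω =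
      a n * coinProd X n ω from fun ω => altUpper_sub_altLower n ω]
  rw [integral_const_mul, hprod n]

/-- The alternating series `Σ (−1)^k a_k p^k` converges (alternating series test, `a_k p^k ↓ 0`);
its sum `f(p)` is the limit of BOTH mean bounds: `E L_n → f(p)` and `E U_n → f(p)`
(condition (5)). [cite: LatuszynskiEtAl2011, §3.1 Proposition 3.4 (proof: "(5) … satisfied with
`s = f(p)`"; "if `a_n → 0`, the algorithm converges for `p ∈ [0,1]`, otherwise for `p ∈ [0,1)`")] -/
theorem tendsto_integral_altBounds [IsProbabilityMeasure μ] (hXm : ∀ k, Measurable (X k))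
    (hX : ∀ k ω, X k ω ∈ Icc (0 : ℝ) 1) (ha : Antitone a) (ha0 : ∀ k, 0 ≤ a k) {p : ℝ}
    (hp01 : p ∈ Icc (0 : ℝ) 1) (hprod : ∀ n, ∫ ω, coinProd X n ω ∂μ = p ^ n)
    (hlim : Tendsto (fun n => a n * p ^ n) atTop (𝓝 0)) :
    ∃ s : ℝ, Tendsto (fun n => ∑ k ∈ range n, (-1) ^ k * (a k * p ^ k)) atTop (𝓝 s) ∧
      Tendsto (fun n => ∫ ω, altLower a X n ω ∂μ) atTop (𝓝 s) ∧
      Tendsto (fun n => ∫ ω, altUpper a X n ω ∂μ) atTop (𝓝 s) := by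
  have hanti : Antitone fun k => a k * p ^ k := by
    refine antitone_nat_of_succ_le fun k => ?_
    calc a (k + 1) * p ^ (k + 1) = a (k + 1) * (p ^ k * p) := by rw [pow_succ]
      _ ≤ a k * (p ^ k * 1) := by
          gcongr
          · exact mul_nonneg (pow_nonneg hp01.1 k) hp01.1
          · exact ha0 k
          · exact ha k.le_succ
          · exact pow_nonneg hp01.1 k
          · exact hp01.2
      _ = a k * p ^ k := by ring
  obtain ⟨s, hs⟩ := hanti.tendsto_alternating_series_of_tendsto_zero hlim
  refine ⟨s, hs, ?_, ?_⟩
  · have e : (fun n => ∫ ω, altLower a X n ω ∂μ) =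
        (fun n => ∑ k ∈ range n, (-1) ^ k * (a k * p ^ k)) ∘ fun n => 2 * ((n + 1) / 2) := by
      ext n
      simp only [Function.comp, altLower]
      exact integral_altPartial hXm hX hprod _
    rw [e]
    exact hs.comp (tendsto_atTop_mono (fun n : ℕ => (by omega : n ≤ 2 * ((n + 1) / 2))) tendsto_id)
  · have e : (fun n => ∫ ω, altUpper a X n ω ∂μ) =
        (fun n => ∑ k ∈ range n, (-1) ^ k * (a k * p ^ k)) ∘ fun n => 2 * (n / 2) + 1 := by
      ext n
      simp only [Function.comp, altUpper]
      exact integral_altPartial hXm hX hprod _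
    rw [e]
    exact hs.comp (tendsto_atTop_mono (fun n : ℕ => (by omega : n ≤ 2 * (n / 2) + 1)) tendsto_id)

/-- Independence of `G` from the coin process makes it independent of the bounds process (which is
a measurable function of the coins). [cite: LatuszynskiEtAl2011, §3.1 Proposition 3.4 (Algorithm 3
driven by the `X_k` and its own uniform `G_0`)] -/
theorem indepFun_altBounds {G : Ω → ℝ} (hind : IndepFun G (fun ω (k : ℕ) => X k ω) μ) :
    IndepFun G (fun ω (n : ℕ) => (altLower a X n ω, altUpper a X n ω)) μ := by
  -- the bounds as a measurable map of the coin sequence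
  let Φ : (ℕ → ℝ) → ℕ → ℝ × ℝ := fun x n =>
    (∑ k ∈ range (2 * ((n + 1) / 2)), (-1) ^ k * (a k * ∏ j ∈ range k, x j),
     ∑ k ∈ range (2 * (n / 2) + 1), (-1) ^ k * (a k * ∏ j ∈ range k, x j))
  have hΦ : Measurable Φ := by
    refine measurable_pi_lambda _ fun n => Measurable.prodMk ?_ ?_
    · exact Finset.measurable_sum _ fun k _ =>
        ((Finset.measurable_prod _ fun j _ => measurable_pi_apply j).const_mul _).const_mul _
    · exact Finset.measurable_sum _ fun k _ =>
        ((Finset.measurable_prod _ fun j _ => measurable_pi_apply j).const_mul _).const_mul _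
  have h := hind.comp measurable_id hΦ
  have e : (Φ ∘ fun ω (k : ℕ) => X k ω) = fun ω (n : ℕ) => (altLower a X n ω, altUpper a X n ω) := by
    ext ω n <;> simp [Φ, altLower, altUpper, altPartial, coinProd]
  rw [e] at h
  exact h

/-- **PROPOSITION 3.4, iteration count**: driven by `[0,1]`-valued independent `p`-coins and an
independent unit uniform `G`, Algorithm 3 with LKPR's alternating-series bounds "needs `N > n`
iterations" with probability exactly `a_n pⁿ`. [cite: LatuszynskiEtAl2011, §3.1 Proposition 3.4] -/
theorem alt_measure_undecided_eq [IsProbabilityMeasure μ] {G : Ω → ℝ} (hG : Measurable G)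
    (hGu : IsUnitUniform μ G) (hXm : ∀ k, Measurable (X k)) (hX : ∀ k ω, X k ω ∈ Icc (0 : ℝ) 1)
    (ha : Antitone a) (ha0 : ∀ k, 0 ≤ a k) (ha1 : a 0 ≤ 1) {p : ℝ}
    (hprod : ∀ n, ∫ ω, coinProd X n ω ∂μ = p ^ n)
    (hind : IndepFun G (fun ω (k : ℕ) => X k ω) μ) (n : ℕ) :
    μ (undecided G (altLower a X) (altUpper a X) n) = ENNReal.ofReal (a n * p ^ n) := by
  rw [measure_undecided_eq (L := altLower a X) (U := altUpper a X) hG hGu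
    (fun n => measurable_altPartial hXm _) (fun n => measurable_altPartial hXm _)
    (fun n ω => altLower_le_altUpper ha0 hX n ω)
    (fun n ω => (altBounds_mem_Icc ha ha0 ha1 hX n ω).1)
    (fun n ω => (altBounds_mem_Icc ha ha0 ha1 hX n ω).2) (fun n ω => altLower_mono ha ha0 hX n ω)
    (fun n ω => altUpper_anti ha ha0 hX n ω) (indepFun_altBounds hind) n,
    integral_altUpper_sub_altLower hXm hX hprod n]

/-- **PROPOSITION 3.4, validity** ("an `f(p)`-coin can be simulated by Algorithm 3"): with
`f(p) = Σ_k (−1)^k a_k pᵏ` (the limit of the alternating partial sums, which exists as soon as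
`a_n pⁿ → 0`), `μ{output 1} = f(p)`, `μ{output 0} = 1 − f(p)` and the run terminates almost surely.
[cite: LatuszynskiEtAl2011, §3.1 Proposition 3.4] -/
theorem alt_measure_outOne_eq [IsProbabilityMeasure μ] {G : Ω → ℝ} (hG : Measurable G)
    (hGu : IsUnitUniform μ G) (hXm : ∀ k, Measurable (X k)) (hX : ∀ k ω, X k ω ∈ Icc (0 : ℝ) 1)
    (ha : Antitone a) (ha0 : ∀ k, 0 ≤ a k) (ha1 : a 0 ≤ 1) {p : ℝ} (hp01 : p ∈ Icc (0 : ℝ) 1)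
    (hprod : ∀ n, ∫ ω, coinProd X n ω ∂μ = p ^ n)
    (hlim : Tendsto (fun n => a n * p ^ n) atTop (𝓝 0))
    (hind : IndepFun G (fun ω (k : ℕ) => X k ω) μ) {s : ℝ}
    (hs : Tendsto (fun n => ∑ k ∈ range n, (-1) ^ k * (a k * p ^ k)) atTop (𝓝 s)) :
    μ (outOne G (altLower a X)) = ENNReal.ofReal s ∧
      μ (outZero G (altUpper a X)) = ENNReal.ofReal (1 - s) ∧
      μ (outOne G (altLower a X) ∪ outZero G (altUpper a X)) = 1 := by
  obtain ⟨s', hs', hl, hu⟩ := tendsto_integral_altBounds hXm hX ha ha0 hp01 hprod hlim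
  have hss : s' = s := tendsto_nhds_unique hs' hs
  subst hss
  have hindB := indepFun_altBounds (a := a) hind
  have hLm : ∀ n, Measurable (altLower a X n) := fun n => measurable_altPartial hXm _
  have hUm : ∀ n, Measurable (altUpper a X n) := fun n => measurable_altPartial hXm _
  refine ⟨measure_outOne_eq hG hGu hLm (fun n ω => (altBounds_mem_Icc ha ha0 ha1 hX n ω).1)
      (fun n ω => altLower_mono ha ha0 hX n ω) hindB hl,
    measure_outZero_eq hG hGu hUm (fun n ω => (altBounds_mem_Icc ha ha0 ha1 hX n ω).2)
      (fun n ω => altUpper_anti ha ha0 hX n ω) hindB hu,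
    measure_terminates hG hGu hLm hUm (fun n ω => altLower_le_altUpper ha0 hX n ω)
      (fun n ω => (altBounds_mem_Icc ha ha0 ha1 hX n ω).1)
      (fun n ω => (altBounds_mem_Icc ha ha0 ha1 hX n ω).2) (fun n ω => altLower_mono ha ha0 hX n ω)
      (fun n ω => altUpper_anti ha ha0 hX n ω) hindB hl hu⟩

/-- The printed remark "`≤ a_n`": the iteration tail is at most `a_n`, uniformly in `p ∈ [0,1]`.
[cite: LatuszynskiEtAl2011, §3.1 Proposition 3.4 (proof: "`a_n pⁿ ≤ a_n`")] -/
theorem alt_measure_undecided_le [IsProbabilityMeasure μ] {G : Ω → ℝ} (hG : Measurable G)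
    (hGu : IsUnitUniform μ G) (hXm : ∀ k, Measurable (X k)) (hX : ∀ k ω, X k ω ∈ Icc (0 : ℝ) 1)
    (ha : Antitone a) (ha0 : ∀ k, 0 ≤ a k) (ha1 : a 0 ≤ 1) {p : ℝ} (hp01 : p ∈ Icc (0 : ℝ) 1)
    (hprod : ∀ n, ∫ ω, coinProd X n ω ∂μ = p ^ n)
    (hind : IndepFun G (fun ω (k : ℕ) => X k ω) μ) (n : ℕ) :
    μ (undecided G (altLower a X) (altUpper a X) n) ≤ ENNReal.ofReal (a n) := by
  rw [alt_measure_undecided_eq hG hGu hXm hX ha ha0 ha1 hprod hind n]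
  exact ENNReal.ofReal_le_ofReal (mul_le_of_le_one_right (ha0 n) (pow_le_one₀ hp01.1 hp01.2))

end AlternatingSeries

end SandwichCoin

end Literature.Probability.MarkovChains

end
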